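import Mathlib

/-!
# The archimedean projection of `Γ ∩ (G_∞ × K_f)` is a discrete subgroup

Kernel form of one sentence of the cell's Tier-5 record (route/T5-N4-p5.md v12, (A3) STEP 1):
«`Γ_i := G(F) ∩ g_i K_f g_i⁻¹` (acting through its archimedean embedding) is discrete in `G_∞`
(`G(F)` is discrete in `G(𝔸)` and `g_i K_f g_i⁻¹` is compact)».

Abstract setting: `G₁` (the archimedean group) a locally compact Hausdorff topological group, `G₂`
(the finite-adelic group) a Hausdorff topological group, `Γ ≤ G₁ × G₂` a discrete subgroup (the
rational points), `C ≤ G₂` a compact subgroup (the level, or its conjugate `g K_f g⁻¹`).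

* `discreteTopology_of_finite_inter_nhds` — a subgroup of a `T1` topological group which meets some
  neighbourhood of `1` in a finite set is discrete.
* `discreteTopology_map_fst` — the projection to `G₁` of `Γ ∩ (G₁ × C)` is a discrete subgroup of
  `G₁` (a compact neighbourhood `U` of `1` in `G₁` gives the compact discrete, hence finite, set
  `Γ ∩ (U × C)`, whose first projection contains the intersection of the projected subgroup with `U`).
* `discreteTopology_map_fst_conj` — the same for the conjugate `g C g⁻¹` of a compact subgroup.
* `finite_inter_prod_bot` — the kernel of the projection, `Γ ∩ ({1} × C)`, is finite.

Nothing about `G(F)`, `G(𝔸)` or the quotient `Γ_i\G_∞` is asserted (the identification of the orbit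
with `Γ_i\G_∞` and its compactness stay prose, [P]); Mathlib only; no definitions.
-/

namespace Summit.Ventures.HodgeRepro2.T5DiscreteProjection

open Topology

section Finite

variable {G : Type*} [Group G] [TopologicalSpace G] [IsTopologicalGroup G]

/-- A subgroup of a `T1` topological group which meets some neighbourhood of `1` in a finite set
is discrete. -/
theorem discreteTopology_of_finite_inter_nhds [T1Space G] (Λ : Subgroup G) {U : Set G}
    (hU : U ∈ 𝓝 (1 : G)) (hfin : ((Λ : Set G) ∩ U).Finite) : DiscreteTopology Λ := by
  rw [discreteTopology_iff_isOpen_singleton_one]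
  set F : Set G := ((Λ : Set G) ∩ U) \ {1} with hF
  have hFfin : F.Finite := hfin.sdiff
  have hFcl : IsClosed F := hFfin.isClosed
  obtain ⟨V, hVU, hVopen, h1V⟩ := mem_nhds_iff.1 hU
  have hW : IsOpen (V ∩ Fᶜ) := hVopen.inter hFcl.isOpen_compl
  have hset : ({1} : Set Λ) = Subtype.val ⁻¹' (V ∩ Fᶜ) := by
    ext x
    simp only [Set.mem_singleton_iff, Set.mem_preimage, Set.mem_inter_iff, Set.mem_compl_iff]
    constructor
    · rintro rfl
      exact ⟨h1V, by simp [hF]⟩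
    · rintro ⟨hxV, hxF⟩
      apply Subtype.ext
      by_contra hx1
      exact hxF ⟨⟨x.2, hVU hxV⟩, hx1⟩
  rw [hset]
  exact hW.preimage continuous_subtype_val

end Finite

section Product

variable {G₁ G₂ : Type*} [Group G₁] [TopologicalSpace G₁] [IsTopologicalGroup G₁] [T2Space G₁]
  [LocallyCompactSpace G₁] [Group G₂] [TopologicalSpace G₂] [IsTopologicalGroup G₂] [T2Space G₂]

omit [LocallyCompactSpace G₁] in
/-- For a discrete subgroup `Γ ≤ G₁ × G₂`, a compact subgroup `C ≤ G₂` and a compact set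
`U ⊆ G₁`, the set `Γ ∩ (U × C)` is finite. -/
theorem finite_inter_prod (Γ : Subgroup (G₁ × G₂)) [DiscreteTopology Γ]
    (C : Subgroup G₂) (hC : IsCompact (C : Set G₂)) {U : Set G₁} (hU : IsCompact U) :
    ((Γ : Set (G₁ × G₂)) ∩ U ×ˢ (C : Set G₂)).Finite := by
  have hΓcl : IsClosed (Γ : Set (G₁ × G₂)) := Subgroup.isClosed_of_discrete
  have hS : IsCompact ((Γ : Set (G₁ × G₂)) ∩ U ×ˢ (C : Set G₂)) :=
    (hU.prod hC).inter_left hΓcl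
  have hSd : IsDiscrete ((Γ : Set (G₁ × G₂)) ∩ U ×ˢ (C : Set G₂)) :=
    (isDiscrete_iff_discreteTopology.2 inferInstance).mono Set.inter_subset_left
  exact hS.finite hSd

/-- Let `Γ` be a discrete subgroup of `G₁ × G₂` and `C` a compact subgroup of `G₂`.  Then the
projection to `G₁` of `Γ ∩ (G₁ × C)` is a discrete subgroup of `G₁`. -/
theorem discreteTopology_map_fst (Γ : Subgroup (G₁ × G₂)) [DiscreteTopology Γ]
    (C : Subgroup G₂) (hC : IsCompact (C : Set G₂)) :
    DiscreteTopology ((Γ ⊓ (⊤ : Subgroup G₁).prod C).map (MonoidHom.fst G₁ G₂)) := by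
  obtain ⟨U, hUc, hU⟩ := exists_compact_mem_nhds (1 : G₁)
  have hSfin := finite_inter_prod Γ C hC hUc
  refine discreteTopology_of_finite_inter_nhds _ hU ((hSfin.image Prod.fst).subset ?_)
  rintro g ⟨hgΛ, hgU⟩
  rw [SetLike.mem_coe, Subgroup.mem_map] at hgΛ
  obtain ⟨x, hx, rfl⟩ := hgΛ
  rw [Subgroup.mem_inf, Subgroup.mem_prod] at hx
  exact ⟨x, ⟨hx.1, hgU, hx.2.2⟩, rfl⟩

omit [T2Space G₂] in
/-- The conjugate `g C g⁻¹` of a compact subgroup is compact. -/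
theorem isCompact_map_conj (C : Subgroup G₂) (hC : IsCompact (C : Set G₂)) (g : G₂) :
    IsCompact ((C.map (MulAut.conj g).toMonoidHom : Subgroup G₂) : Set G₂) := by
  rw [Subgroup.coe_map]
  have hcont : Continuous fun x : G₂ => (MulAut.conj g).toMonoidHom x := by
    simp only [MulEquiv.coe_toMonoidHom, MulAut.conj_apply]
    fun_prop
  exact hC.image hcont

/-- The same with the conjugate `g C g⁻¹` of a compact subgroup `C` (the level
`g_i K_f g_i⁻¹` of the record). -/
theorem discreteTopology_map_fst_conj (Γ : Subgroup (G₁ × G₂)) [DiscreteTopology Γ]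
    (C : Subgroup G₂) (hC : IsCompact (C : Set G₂)) (g : G₂) :
    DiscreteTopology ((Γ ⊓ (⊤ : Subgroup G₁).prod (C.map (MulAut.conj g).toMonoidHom)).map
      (MonoidHom.fst G₁ G₂)) :=
  discreteTopology_map_fst Γ _ (isCompact_map_conj C hC g)

omit [LocallyCompactSpace G₁] in
/-- The kernel of the projection, `Γ ∩ ({1} × C)`, is finite. -/
theorem finite_inter_prod_bot (Γ : Subgroup (G₁ × G₂)) [DiscreteTopology Γ]
    (C : Subgroup G₂) (hC : IsCompact (C : Set G₂)) :
    ((Γ ⊓ (⊥ : Subgroup G₁).prod C : Subgroup (G₁ × G₂)) : Set (G₁ × G₂)).Finite := by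
  refine (finite_inter_prod Γ C hC isCompact_singleton (U := {1})).subset ?_
  intro x hx
  rw [SetLike.mem_coe, Subgroup.mem_inf, Subgroup.mem_prod, Subgroup.mem_bot] at hx
  exact ⟨hx.1, by simpa using hx.2.1, hx.2.2⟩

end Product

end Summit.Ventures.HodgeRepro2.T5DiscreteProjection
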